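import Summits.BirchSwinnertonDyer.Rank1Residual.X4.KolyvaginIndexRecordsKitOddPrime
import HarnessLib

/-!
# BSD rank-≤1 residual cell, lane class X11b (`p ∥ N`: MULTIPLICATIVE at a prime `p ≥ 5`, `ρ̄_{E,p}` irreducible),
rank ONE: `BSD(E,p)` PER PAIR from
# PUBLISHED theorems + Kolyvagin's HEEGNER-INDEX certificate (two engines), `ρ̄_{E,p}` onto IN THE KERNEL — records 23

HONEST FRAMING (cell `b2b-bsdres-*`, verbatim): prove what is provable now; shrink each hard class to its core with
data; no claim beyond stated classes; COMBINATION classes deleted from PUBLISHED theorems only, CONSTRUCTION-shaped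
remainder typed; this is not "finishing BSD". X11b stays CONSTRUCTION-SHAPED; everything here is PER PAIR; no lane
verdict is changed; no named fact is introduced (debt 0); nothing is booked by this unit (the rung-K2 owner
bsd-stepL, the x11b
lineage that holds row B9's E1/K2 claim, census-lead, the Kurihara lane and referee A decide what a record is
worth); Cremona's numbers
(`r_an = 1`, `#Ш_an`, models, generators, `∏ c_ℓ`, torsion, optimality / Manin codes, the galrep datum) are INPUTS.

Unit `b2b-bsdres-x11c`, GEN 32 (prover-b2b-bsdres-x11c-g32-0) — the «X11 beyond 3» half of the unit's D-0075 purpose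
(«GRH-free
Kolyvagin–Heegner-index certificates X4 r1 p ≥ 7, X11 beyond 3»): the cell's certificate engines turned on lane
class X11b as GEN 27–31 turned
them on X7 (`Supersingular/KolyvaginIndexRecordsX7RankOne01–432`). POPULATION
(`HOME/b2b-bsdres-x11c/gen32/pop/build_harvest_x11b.py` = gen 27's
class-agnostic census restricted to X11b with a per-(label, p) record test): the rank-ONE classes (Cremona curve 1,
non-CM) whose cell
`(p, X11b)` — `p ≥ 5`, `p ∥ N` — is OPEN on the Kurihara lane's residue of record (bsdN sweep v4u `RESIDUE.jsonl` ×
v5u verdict `residue`; on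
848 of them the lane's own tail is T-KOLY, whose single certified Heegner field excludes the primes dividing
`m·D_K`) and which are
certificate-shaped on Cremona's data — no galrep code at `p` (`ρ̄_{E,p}` onto), `p ∤ #E(ℚ)_tors·∏ c_ℓ` (so
`p ∤ c_p = ord_p Δ` at a split
`p`), `p ∤ #Ш_an` — and carry no Kolyvagin-index record `bsdp_k<label>_<p>`: 927 pairs on 869 classes (`p = 5`: 605,
`7`: 221, `11`: 41,
`13`: 20, `17 ≤ p ≤ 103`: 40; split 411 / non-split 516; 268 semistable; `1.6·10⁴ < N < 5·10⁵`). 920 of them ALSO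
carry the unit's GEN 10
beyond-window DATA record (`X11b/BeyondWindowRecordsNN`: Skinner 2016 Thm. A ∘ Stein–Wuthrich 2013 `p`-adic road,
binders as displayed there)
— for those this file is a SECOND, GRH-free and main-conjecture-free road; 7 carry no per-pair record. Not in reach
of this route (numbers, not
a verdict): the lane's 3 062 Tamagawa-obstructed X11b rank-one cells at `p ≥ 5` (`p ∣ c_q` for some `q`; Jetchev
2008's Hypothesis (∗)
`p ∤ N` fails at `p ∥ N`). THIS FILE (records 23): 10 pairs — `297660g1@5`, `299880cl1@5`, `299880dj1@5`,
`299880o1@5`, `300390o1@5`, `302430g1@5`, `302820f1@5`, `303030bz1@5`, `303240a1@5`, `305760b1@5`. 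

THE ROUTE (the unit's GEN 26/27 Kolyvagin route, class-agnostic): Kolyvagin's theorem as PRINTED by McCallum (LMS LN
153 (1991) §1, p. 296) /
Gross (ibid., Prop. 2.1 (2)) — tree named facts `kolyvagin`, `Kolyvagin1990_padicValNat_card_sha_le`, whose printed
hypotheses are `y_K` of
infinite order, `p` odd, `ρ̄_{E,p}` onto, and NOTHING about the reduction of `E` at `p` (at `p ∥ N` the Heegner
hypothesis — every prime of
`N` split in `K` — makes `p` split in `K`; nothing more is asked) —: `ord_p #Ш(E/K) ≤ 2·ord_p [E(K):ℤy_K]`; so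
`p ∤ [E(K):ℤy_K]` gives
`Ш(E/K)[p] = 0`, hence `Ш(E/ℚ)[p] = 0`, and with `ord_p #Ш_an = 0` Miller's `BSD(E,p)` — the tree's class-agnostic
consumer
`Typed.bsdp_of_kolyvagin_of_not_dvd_index` (`Literature/…/Rank1Residual/Typed/KolyvaginCertificate.lean`).

THE CERTIFICATE (per pair; the cell's EXISTING engines run VERBATIM — no private engine, no knob; ONE batched kit
job per stage with an
in-job fan-out wrapper): engine 1 = gen 3's `engine1_cha1b/main.py` = x9-g7 `jobD1b.py` (cypari2, sha256
`69e29ec7…`; rank-one mode: Heegner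
fields `K = ℚ(√D)`, `D < -4` fundamental, every prime of `N` split, `p ∤ D`, increasing `|D| ≤ 6000`, `≤ 30` fields;
root number of `E^D`
`+1`, rank-`≥ 2` twists skipped; `hy = L'(E,1)·L(E^D,1)·√|D|/(4·Area(E))`, `ρ = hy/ĥ(x)`, `m = √(4ρ)` an integer,
CERT iff `p ∤ m` —
Miller 2011 Thm. 4.1 / Cor. 4.8); engine 2 = gen 3's `engine2/run_cert.py` (`1b54bb20…`) + `e2lib.py` (`6701e05d…`)
+ `tate_stdlib.py`
(`ed9e5fd9…`) (stdlib python: independent `L`-series, AGM periods, Tate heights; `m`, `ord_p m` must be EQUAL;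
discrete checks — model,
conductor, Tamagawa, non-CM, irreducibility / saturation / `E(K)[p] = 0` witnesses, `D` Heegner); twist values =
additive-p1's
`twistvals/main.py` (`e501b988…`). Kit jobs: j259809, j260662, j260664, j260666, j260667. Evidence:
`HOME/b2b-bsdres-x11c/gen32/` (`KOLY-X11BR1-TABLE.md`, outputs, inputs,
SHA256SUMS); REPORT.md §41.

KERNEL (per pair, through the unit's kit theorem `X4.bsdp_prime_of_kolyvaginIndex_of_serreCounts` of
`X4/KolyvaginIndexRecordsKitOddPrime.lean` — class-agnostic despite its namespace —, every numeric hypothesis a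
`decide` goal): `Δ ≠ 0`;
global minimality of Cremona's model (bounded Kraus criterion); `ρ̄_{E,p}` ONTO by Serre's Prop. 19 from three
witness primes
`(ℓ₁, ℓ₂, ℓ₃)` (types s₁ split / s₂ non-split / s₃ `u = a²/ℓ ∉ {0,1,2,4}`, `u² − 3u + 1 ≢ 0`) whose point counts
`#Ẽ(𝔽_ℓ)` (schema
`countPoints`) are evaluated in the kernel. BINDERS (displayed in every theorem): `hGZK` (Gross–Zagier–Kolyvagin),
`hKo` / `hB` (Kolyvagin
as printed), the Heegner datum (`K`, level `N`, `P`, `p ∤ [E(K):ℤP]`), `r_an ≤ 1`, `#Ш_an = q` with `ord_p q = 0`.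
NOT rechecked in the
kernel (engine work): `L'(E,1)`, `L(E^D,1)`, periods, heights, saturation, the integrality of `4ρ`; nor the lane's
class bit (`p ∥ N`,
split / non-split — bookkeeping only, the route does not use it). What a record is worth is the owners' / lane's /
referee's call
(EVIDENCE-grade certificate under displayed binders, as every Heegner-index record of the cell).

References: McCallum 1991 §1 [McCallumLMS1991]; Gross 1991 Prop. 2.1 [GrossLMS1991]; Kolyvagin 1990
[KolyvaginEulerSystems1990]; Serre 1972 §2.8 Prop. 19 [Serre1972]; Miller 2011 Def. 1.1, Thm. 4.1, Cor. 4.8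
[Miller2011LMS];
Silverman AEC VII.1, VIII.8 [SilvermanAEC2009]; Cremona's tables [Cremona2006].
-/

set_option autoImplicit false

noncomputable section

open scoped Classical

open WeierstrassCurve Literature.NumberTheory.EllipticCurves
  Literature.NumberTheory.EllipticCurves.Rank1Residual
  Literature.NumberTheory.EllipticCurves.Rank1Residual.Typed
  Literature.NumberTheory.EllipticCurves.Rank1Residual.X11RankOneCertificates
  Summit.BirchSwinnertonDyer.BirchSwinnertonDyer.Rank1Residual.IntModel
  Summit.BirchSwinnertonDyer.BirchSwinnertonDyer.Rank1Residual.X11RankOne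
  Summit.BirchSwinnertonDyer.Rank1Residual.X4

namespace Summit.BirchSwinnertonDyer.Rank1Residual.X11b

/-- **`BSD(E,5)` for `297660g1`** (`N = 297660 = 2²·3·5·11²·41`; NON-SPLIT MULTIPLICATIVE at `5` (Kodaira `I1`, `c_5 = 1`, additive at `2`, `11`);
`#tors = 1`, `∏c = 2`, `r_an = 1`, `#Ш_an = 1`, generator `(181/4, 3091/8)`; lane residue cell `(5, X11b)` (bsdN v4u/v5u of record: `residue:X11b`,
lane tail T-KOLY); ALSO the unit's GEN 10 beyond-window DATA record in `X11b/BeyondWindowRecords36.lean` (Skinner 2016 Thm. A ∘ Stein–Wuthrich 2013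
`p`-adic road, binders as displayed there) — this row is a SECOND road). `D = -1559` (1559 prime): **`m = [E(K):ℤy_K] = 4`, `5 ∤ m`** (`ρ = 4.00…`;
`L'(E,1) = 5.76634652…`, `L(E^D,1) = 0.03016262…`, `ĥ(x) = 4.69252736…`) — engine 1 (j259809) = engine 2 (j260662; EQUAL, dev. ≤ 2.4·10⁻¹³, checks
true); twist `E^D` (j260667): `#tors·∏c·#Ш_an = 1·4·1`, prime to `5` — BSD-consistent. Witnesses mod `5` `(ℓ,#Ẽ(𝔽_ℓ))` = `(13,10)` (`a = 4`,
`a² − 4ℓ ≡ 4` square), `(7,9)` (`a = -1`, `a² − 4ℓ ≡ 3` non-square), `(7,9)` (`u ≡ 3`).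
[cite: McCallumLMS1991, §1 Theorem (Kolyvagin), p. 296] [cite: Serre1972, §2.8 Prop. 19] [cite: Cremona2006, Table 1 (label 297660g1)] -/
theorem bsdp_k297660g1_5 (hGZK : rank_eq_analyticRank_of_analyticRank_le_one) (W : WeierstrassCurve ℚ)
    (hW : W = ⟨0, -1, 0, -2636, 177960⟩) {N : ℕ} [NeZero N] {K : Type} [Field K] [NumberField K]
    (hKo : kolyvagin N W K) (hB : Kolyvagin1990_padicValNat_card_sha_le N W K) (hK : IsImaginaryQuadratic K)
    (hH : SatisfiesHeegnerHypothesis N K) {P : (W.baseChange K).toAffine.Point} (hP : IsHeegnerPoint N W K P)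
    (hnt : ¬ IsOfFinAddOrder P) (hI : ¬ 5 ∣ (AddSubgroup.zmultiples P).index) (hr : W.analyticRank ≤ 1)
    {q : ℚ} (hq : shaAn W = (q : ℂ)) (hv : padicValRat 5 q = 0) : BSDp W 5 :=
  bsdp_prime_of_kolyvaginIndex_of_serreCounts 5 (by norm_num) (by norm_num) 0 (-1) 0 (-2636) 177960 (by decide +kernel)
    (by decide +kernel) (by decide +kernel) 13 7 7 (by norm_num) (by norm_num) (by norm_num) (by norm_num)
    (by norm_num) (by norm_num) (by norm_num) (by norm_num) (by norm_num) (by decide +kernel) (by decide +kernel)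
    (by decide +kernel) (n₁ := 10) (n₂ := 9) (n₃ := 9) (hc₁ := by decide +kernel) (hc₂ := by decide +kernel)
    (hc₃ := by decide +kernel) (by decide +kernel) (by decide +kernel) (by decide +kernel) hGZK W
    (by rw [hW]; norm_num) hKo hB hK hH hP hnt hI hr hq hv

/-- **`BSD(E,5)` for `299880cl1`** (`N = 299880 = 2³·3²·5·7²·17`; NON-SPLIT MULTIPLICATIVE at `5` (Kodaira `I1`, `c_5 = 1`, additive at `2`, `3`, `7`);
`#tors = 2`, `∏c = 16`, `r_an = 1`, `#Ш_an = 1`, generator `(948451/4225, 1336035176/274625)`; lane residue cell `(5, X11b)` (bsdN v4u/v5u of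
record: `residue:X11b`, lane tail T-KOLY); ALSO the unit's GEN 10 beyond-window DATA record in `X11b/BeyondWindowRecords36.lean` (Skinner 2016 Thm.
A ∘ Stein–Wuthrich 2013 `p`-adic road, binders as displayed there) — this row is a SECOND road). `D = -1679` (1679 = 23·73):
**`m = [E(K):ℤy_K] = 16`, `5 ∤ m`** (`ρ = 64.00…`; `L'(E,1) = 9.44202844…`, `L(E^D,1) = 0.18191456…`, `ĥ(x) = 11.75014523…`) — engine 1 (j259809) =
engine 2 (j260662; EQUAL, dev. ≤ 9.4·10⁻¹⁴, checks true); twist `E^D` (j260667): `#tors·∏c·#Ш_an = 2·128·1`, prime to `5` — BSD-consistent.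
Witnesses mod `5` `(ℓ,#Ẽ(𝔽_ℓ))` = `(23,28)` (`a = -4`, `a² − 4ℓ ≡ 4` square), `(11,6)` (`a = 6`, `a² − 4ℓ ≡ 2` non-square), `(13,12)` (`u ≡ 3`).
[cite: McCallumLMS1991, §1 Theorem (Kolyvagin), p. 296] [cite: Serre1972, §2.8 Prop. 19] [cite: Cremona2006, Table 1 (label 299880cl1)] -/
theorem bsdp_k299880cl1_5 (hGZK : rank_eq_analyticRank_of_analyticRank_le_one) (W : WeierstrassCurve ℚ)
    (hW : W = ⟨0, 0, 0, 78057, -5167638⟩) {N : ℕ} [NeZero N] {K : Type} [Field K] [NumberField K]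
    (hKo : kolyvagin N W K) (hB : Kolyvagin1990_padicValNat_card_sha_le N W K) (hK : IsImaginaryQuadratic K)
    (hH : SatisfiesHeegnerHypothesis N K) {P : (W.baseChange K).toAffine.Point} (hP : IsHeegnerPoint N W K P)
    (hnt : ¬ IsOfFinAddOrder P) (hI : ¬ 5 ∣ (AddSubgroup.zmultiples P).index) (hr : W.analyticRank ≤ 1)
    {q : ℚ} (hq : shaAn W = (q : ℂ)) (hv : padicValRat 5 q = 0) : BSDp W 5 :=
  bsdp_prime_of_kolyvaginIndex_of_serreCounts 5 (by norm_num) (by norm_num) 0 0 0 78057 (-5167638) (by decide +kernel)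
    (by decide +kernel) (by decide +kernel) 23 11 13 (by norm_num) (by norm_num) (by norm_num) (by norm_num)
    (by norm_num) (by norm_num) (by norm_num) (by norm_num) (by norm_num) (by decide +kernel) (by decide +kernel)
    (by decide +kernel) (n₁ := 28) (n₂ := 6) (n₃ := 12) (hc₁ := by decide +kernel) (hc₂ := by decide +kernel)
    (hc₃ := by decide +kernel) (by decide +kernel) (by decide +kernel) (by decide +kernel) hGZK W
    (by rw [hW]; norm_num) hKo hB hK hH hP hnt hI hr hq hv

/-- **`BSD(E,5)` for `299880dj1`** (`N = 299880 = 2³·3²·5·7²·17`; SPLIT MULTIPLICATIVE at `5` (Kodaira `I1`, `c_5 = 1`, additive at `2`, `3`, `7`);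
`#tors = 2`, `∏c = 16`, `r_an = 1`, `#Ш_an = 1`, generator Cremona's (13-digit numerator); lane residue cell `(5, X11b)` (bsdN v4u/v5u of record:
`residue:X11b`, lane tail T-KOLY); ALSO the unit's GEN 10 beyond-window DATA record in `X11b/BeyondWindowRecords36.lean` (Skinner 2016 Thm. A ∘
Stein–Wuthrich 2013 `p`-adic road, binders as displayed there) — this row is a SECOND road). `D = -1511` (1511 prime): **`m = [E(K):ℤy_K] = 32`,
`5 ∤ m`** (`ρ = 256.00…`; `L'(E,1) = 9.01830829…`, `L(E^D,1) = 0.14634569…`, `ĥ(x) = 26.66313776…`) — engine 1 (j259809) = engine 2 (j260662; EQUAL,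
dev. ≤ 5.8·10⁻¹⁴, checks true); twist `E^D` (j260667): `#tors·∏c·#Ш_an = 2·32·16`, prime to `5` — BSD-consistent. Witnesses mod `5` `(ℓ,#Ẽ(𝔽_ℓ))` =
`(43,38)` (`a = 6`, `a² − 4ℓ ≡ 4` square), `(13,12)` (`a = 2`, `a² − 4ℓ ≡ 2` non-square), `(13,12)` (`u ≡ 3`).
[cite: McCallumLMS1991, §1 Theorem (Kolyvagin), p. 296] [cite: Serre1972, §2.8 Prop. 19] [cite: Cremona2006, Table 1 (label 299880dj1)] -/
theorem bsdp_k299880dj1_5 (hGZK : rank_eq_analyticRank_of_analyticRank_le_one) (W : WeierstrassCurve ℚ)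
    (hW : W = ⟨0, 0, 0, -3372327, 20082904506⟩) {N : ℕ} [NeZero N] {K : Type} [Field K] [NumberField K]
    (hKo : kolyvagin N W K) (hB : Kolyvagin1990_padicValNat_card_sha_le N W K) (hK : IsImaginaryQuadratic K)
    (hH : SatisfiesHeegnerHypothesis N K) {P : (W.baseChange K).toAffine.Point} (hP : IsHeegnerPoint N W K P)
    (hnt : ¬ IsOfFinAddOrder P) (hI : ¬ 5 ∣ (AddSubgroup.zmultiples P).index) (hr : W.analyticRank ≤ 1)
    {q : ℚ} (hq : shaAn W = (q : ℂ)) (hv : padicValRat 5 q = 0) : BSDp W 5 :=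
  bsdp_prime_of_kolyvaginIndex_of_serreCounts 5 (by norm_num) (by norm_num) 0 0 0 (-3372327) 20082904506 (by decide +kernel)
    (by decide +kernel) (by decide +kernel) 43 13 13 (by norm_num) (by norm_num) (by norm_num) (by norm_num)
    (by norm_num) (by norm_num) (by norm_num) (by norm_num) (by norm_num) (by decide +kernel) (by decide +kernel)
    (by decide +kernel) (n₁ := 38) (n₂ := 12) (n₃ := 12) (hc₁ := by decide +kernel) (hc₂ := by decide +kernel)
    (hc₃ := by decide +kernel) (by decide +kernel) (by decide +kernel) (by decide +kernel) hGZK W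
    (by rw [hW]; norm_num) hKo hB hK hH hP hnt hI hr hq hv

/-- **`BSD(E,5)` for `299880o1`** (`N = 299880 = 2³·3²·5·7²·17`; NON-SPLIT MULTIPLICATIVE at `5` (Kodaira `I5`, `c_5 = 1`, additive at `2`, `3`, `7`);
`#tors = 2`, `∏c = 64`, `r_an = 1`, `#Ш_an = 1`, generator `(3619077581/1681, 217720345342374/68921)`; lane residue cell `(5, X11b)` (bsdN v4u/v5u
of record: `residue:X11b`, lane tail T-KOLY); ALSO the unit's GEN 10 beyond-window DATA record in `X11b/BeyondWindowRecords36.lean` (Skinner 2016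
Thm. A ∘ Stein–Wuthrich 2013 `p`-adic road, binders as displayed there) — this row is a SECOND road). `D = -1511` (1511 prime):
**`m = [E(K):ℤy_K] = 448`, `5 ∤ m`** (`ρ = 50176.00…`; `L'(E,1) = 6.27325697…`, `L(E^D,1) = 6.17811073…`, `ĥ(x) = 16.41000621…`) — engine 1
(j259809) = engine 2 (j260662; EQUAL, dev. ≤ 3.0·10⁻¹⁴, checks true); twist `E^D` (j260667): `#tors·∏c·#Ш_an = 2·128·196`, prime to `5` —
BSD-consistent. Witnesses mod `5` `(ℓ,#Ẽ(𝔽_ℓ))` = `(13,8)` (`a = 6`, `a² − 4ℓ ≡ 4` square), `(11,16)` (`a = -4`, `a² − 4ℓ ≡ 2` non-square),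
`(67,72)` (`u ≡ 3`).
[cite: McCallumLMS1991, §1 Theorem (Kolyvagin), p. 296] [cite: Serre1972, §2.8 Prop. 19] [cite: Cremona2006, Table 1 (label 299880o1)] -/
theorem bsdp_k299880o1_5 (hGZK : rank_eq_analyticRank_of_analyticRank_le_one) (W : WeierstrassCurve ℚ)
    (hW : W = ⟨0, 0, 0, 47067342, -1381451587607⟩) {N : ℕ} [NeZero N] {K : Type} [Field K] [NumberField K]
    (hKo : kolyvagin N W K) (hB : Kolyvagin1990_padicValNat_card_sha_le N W K) (hK : IsImaginaryQuadratic K)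
    (hH : SatisfiesHeegnerHypothesis N K) {P : (W.baseChange K).toAffine.Point} (hP : IsHeegnerPoint N W K P)
    (hnt : ¬ IsOfFinAddOrder P) (hI : ¬ 5 ∣ (AddSubgroup.zmultiples P).index) (hr : W.analyticRank ≤ 1)
    {q : ℚ} (hq : shaAn W = (q : ℂ)) (hv : padicValRat 5 q = 0) : BSDp W 5 :=
  bsdp_prime_of_kolyvaginIndex_of_serreCounts 5 (by norm_num) (by norm_num) 0 0 0 47067342 (-1381451587607) (by decide +kernel)
    (by decide +kernel) (by decide +kernel) 13 11 67 (by norm_num) (by norm_num) (by norm_num) (by norm_num)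
    (by norm_num) (by norm_num) (by norm_num) (by norm_num) (by norm_num) (by decide +kernel) (by decide +kernel)
    (by decide +kernel) (n₁ := 8) (n₂ := 16) (n₃ := 72) (hc₁ := by decide +kernel) (hc₂ := by decide +kernel)
    (hc₃ := by decide +kernel) (by decide +kernel) (by decide +kernel) (by decide +kernel) hGZK W
    (by rw [hW]; norm_num) hKo hB hK hH hP hnt hI hr hq hv

/-- **`BSD(E,5)` for `300390o1`** (`N = 300390 = 2·3·5·17·19·31`; NON-SPLIT MULTIPLICATIVE at `5` (Kodaira `I3`, `c_5 = 1`, semistable); `#tors = 1`,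
`∏c = 2`, `r_an = 1`, `#Ш_an = 1`, generator `(-1, 12)`; lane residue cell `(5, X11b)` (bsdN v4u/v5u of record: `residue:X11b`, lane tail T-KOLY);
ALSO the unit's GEN 10 beyond-window DATA record in `X11b/BeyondWindowRecords37.lean` (Skinner 2016 Thm. A ∘ Stein–Wuthrich 2013 `p`-adic road,
binders as displayed there) — this row is a SECOND road). `D = -3719` (3719 prime): **`m = [E(K):ℤy_K] = 8`, `5 ∤ m`** (`ρ = 15.99…`;
`L'(E,1) = 5.80265044…`, `L(E^D,1) = 0.29381635…`, `ĥ(x) = 1.83014760…`) — engine 1 (j259809) = engine 2 (j260664; EQUAL, dev. ≤ 4.8·10⁻¹⁴, checks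
true); twist `E^D` (j260667): `#tors·∏c·#Ш_an = 1·4·4`, prime to `5` — BSD-consistent. Witnesses mod `5` `(ℓ,#Ẽ(𝔽_ℓ))` = `(7,5)` (`a = 3`,
`a² − 4ℓ ≡ 1` square), `(23,27)` (`a = -3`, `a² − 4ℓ ≡ 2` non-square), `(23,27)` (`u ≡ 3`).
[cite: McCallumLMS1991, §1 Theorem (Kolyvagin), p. 296] [cite: Serre1972, §2.8 Prop. 19] [cite: Cremona2006, Table 1 (label 300390o1)] -/
theorem bsdp_k300390o1_5 (hGZK : rank_eq_analyticRank_of_analyticRank_le_one) (W : WeierstrassCurve ℚ)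
    (hW : W = ⟨1, 0, 1, 31, 176⟩) {N : ℕ} [NeZero N] {K : Type} [Field K] [NumberField K]
    (hKo : kolyvagin N W K) (hB : Kolyvagin1990_padicValNat_card_sha_le N W K) (hK : IsImaginaryQuadratic K)
    (hH : SatisfiesHeegnerHypothesis N K) {P : (W.baseChange K).toAffine.Point} (hP : IsHeegnerPoint N W K P)
    (hnt : ¬ IsOfFinAddOrder P) (hI : ¬ 5 ∣ (AddSubgroup.zmultiples P).index) (hr : W.analyticRank ≤ 1)
    {q : ℚ} (hq : shaAn W = (q : ℂ)) (hv : padicValRat 5 q = 0) : BSDp W 5 :=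
  bsdp_prime_of_kolyvaginIndex_of_serreCounts 5 (by norm_num) (by norm_num) 1 0 1 31 176 (by decide +kernel)
    (by decide +kernel) (by decide +kernel) 7 23 23 (by norm_num) (by norm_num) (by norm_num) (by norm_num)
    (by norm_num) (by norm_num) (by norm_num) (by norm_num) (by norm_num) (by decide +kernel) (by decide +kernel)
    (by decide +kernel) (n₁ := 5) (n₂ := 27) (n₃ := 27) (hc₁ := by decide +kernel) (hc₂ := by decide +kernel)
    (hc₃ := by decide +kernel) (by decide +kernel) (by decide +kernel) (by decide +kernel) hGZK W
    (by rw [hW]; norm_num) hKo hB hK hH hP hnt hI hr hq hv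

/-- **`BSD(E,5)` for `302430g1`** (`N = 302430 = 2·3·5·17·593`; SPLIT MULTIPLICATIVE at `5` (Kodaira `I1`, `c_5 = 1`, semistable); `#tors = 1`,
`∏c = 8`, `r_an = 1`, `#Ш_an = 1`, generator `(102, 535)`; lane residue cell `(5, X11b)` (bsdN v4u/v5u of record: `residue:X11b`, lane tail T-KOLY);
ALSO the unit's GEN 10 beyond-window DATA record in `X11b/BeyondWindowRecords37.lean` (Skinner 2016 Thm. A ∘ Stein–Wuthrich 2013 `p`-adic road,
binders as displayed there) — this row is a SECOND road). `D = -1631` (1631 = 7·233): **`m = [E(K):ℤy_K] = 96`, `5 ∤ m`** (`ρ = 2304.00…`;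
`L'(E,1) = 11.66421092…`, `L(E^D,1) = 2.23522978…`, `ĥ(x) = 2.50186643…`) — engine 1 (j259809) = engine 2 (j260664; EQUAL, dev. ≤ 4.6·10⁻¹⁴, checks
true); twist `E^D` (j260667): `#tors·∏c·#Ш_an = 1·32·9`, prime to `5` — BSD-consistent. Witnesses mod `5` `(ℓ,#Ẽ(𝔽_ℓ))` = `(13,10)` (`a = 4`,
`a² − 4ℓ ≡ 4` square), `(23,22)` (`a = 2`, `a² − 4ℓ ≡ 2` non-square), `(23,22)` (`u ≡ 3`).
[cite: McCallumLMS1991, §1 Theorem (Kolyvagin), p. 296] [cite: Serre1972, §2.8 Prop. 19] [cite: Cremona2006, Table 1 (label 302430g1)] -/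
theorem bsdp_k302430g1_5 (hGZK : rank_eq_analyticRank_of_analyticRank_le_one) (W : WeierstrassCurve ℚ)
    (hW : W = ⟨1, 0, 1, -53933, 4781288⟩) {N : ℕ} [NeZero N] {K : Type} [Field K] [NumberField K]
    (hKo : kolyvagin N W K) (hB : Kolyvagin1990_padicValNat_card_sha_le N W K) (hK : IsImaginaryQuadratic K)
    (hH : SatisfiesHeegnerHypothesis N K) {P : (W.baseChange K).toAffine.Point} (hP : IsHeegnerPoint N W K P)
    (hnt : ¬ IsOfFinAddOrder P) (hI : ¬ 5 ∣ (AddSubgroup.zmultiples P).index) (hr : W.analyticRank ≤ 1)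
    {q : ℚ} (hq : shaAn W = (q : ℂ)) (hv : padicValRat 5 q = 0) : BSDp W 5 :=
  bsdp_prime_of_kolyvaginIndex_of_serreCounts 5 (by norm_num) (by norm_num) 1 0 1 (-53933) 4781288 (by decide +kernel)
    (by decide +kernel) (by decide +kernel) 13 23 23 (by norm_num) (by norm_num) (by norm_num) (by norm_num)
    (by norm_num) (by norm_num) (by norm_num) (by norm_num) (by norm_num) (by decide +kernel) (by decide +kernel)
    (by decide +kernel) (n₁ := 10) (n₂ := 22) (n₃ := 22) (hc₁ := by decide +kernel) (hc₂ := by decide +kernel)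
    (hc₃ := by decide +kernel) (by decide +kernel) (by decide +kernel) (by decide +kernel) hGZK W
    (by rw [hW]; norm_num) hKo hB hK hH hP hnt hI hr hq hv

/-- **`BSD(E,5)` for `302820f1`** (`N = 302820 = 2²·3·5·7²·103`; NON-SPLIT MULTIPLICATIVE at `5` (Kodaira `I11`, `c_5 = 1`, additive at `2`, `7`);
`#tors = 1`, `∏c = 1`, `r_an = 1`, `#Ш_an = 1`, generator Cremona's (9-digit numerator); lane residue cell `(5, X11b)` (bsdN v4u/v5u of record:
`residue:X11b`, lane tail T-KOLY); ALSO the unit's GEN 10 beyond-window DATA record in `X11b/BeyondWindowRecords37.lean` (Skinner 2016 Thm. A ∘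
Stein–Wuthrich 2013 `p`-adic road, binders as displayed there) — this row is a SECOND road). `D = -1511` (1511 prime): **`m = [E(K):ℤy_K] = 4`,
`5 ∤ m`** (`ρ = 3.99…`; `L'(E,1) = 5.06592834…`, `L(E^D,1) = 0.09468305…`, `ĥ(x) = 19.89066960…`) — engine 1 (j259809) = engine 2 (j260664; EQUAL,
dev. ≤ 6.8·10⁻¹⁴, checks true); twist `E^D` (j260667): `#tors·∏c·#Ш_an = 1·2·4`, prime to `5` — BSD-consistent. Witnesses mod `5` `(ℓ,#Ẽ(𝔽_ℓ))` =
`(17,20)` (`a = -2`, `a² − 4ℓ ≡ 1` square), `(11,8)` (`a = 4`, `a² − 4ℓ ≡ 2` non-square), `(13,16)` (`u ≡ 3`).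
[cite: McCallumLMS1991, §1 Theorem (Kolyvagin), p. 296] [cite: Serre1972, §2.8 Prop. 19] [cite: Cremona2006, Table 1 (label 302820f1)] -/
theorem bsdp_k302820f1_5 (hGZK : rank_eq_analyticRank_of_analyticRank_le_one) (W : WeierstrassCurve ℚ)
    (hW : W = ⟨0, -1, 0, -1556, -661800⟩) {N : ℕ} [NeZero N] {K : Type} [Field K] [NumberField K]
    (hKo : kolyvagin N W K) (hB : Kolyvagin1990_padicValNat_card_sha_le N W K) (hK : IsImaginaryQuadratic K)
    (hH : SatisfiesHeegnerHypothesis N K) {P : (W.baseChange K).toAffine.Point} (hP : IsHeegnerPoint N W K P)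
    (hnt : ¬ IsOfFinAddOrder P) (hI : ¬ 5 ∣ (AddSubgroup.zmultiples P).index) (hr : W.analyticRank ≤ 1)
    {q : ℚ} (hq : shaAn W = (q : ℂ)) (hv : padicValRat 5 q = 0) : BSDp W 5 :=
  bsdp_prime_of_kolyvaginIndex_of_serreCounts 5 (by norm_num) (by norm_num) 0 (-1) 0 (-1556) (-661800) (by decide +kernel)
    (by decide +kernel) (by decide +kernel) 17 11 13 (by norm_num) (by norm_num) (by norm_num) (by norm_num)
    (by norm_num) (by norm_num) (by norm_num) (by norm_num) (by norm_num) (by decide +kernel) (by decide +kernel)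
    (by decide +kernel) (n₁ := 20) (n₂ := 8) (n₃ := 16) (hc₁ := by decide +kernel) (hc₂ := by decide +kernel)
    (hc₃ := by decide +kernel) (by decide +kernel) (by decide +kernel) (by decide +kernel) hGZK W
    (by rw [hW]; norm_num) hKo hB hK hH hP hnt hI hr hq hv

/-- **`BSD(E,5)` for `303030bz1`** (`N = 303030 = 2·3²·5·7·13·37`; SPLIT MULTIPLICATIVE at `5` (Kodaira `I1`, `c_5 = 1`, additive at `3`); `#tors = 2`,
`∏c = 16`, `r_an = 1`, `#Ш_an = 1`, generator Cremona's (15-digit numerator); lane residue cell `(5, X11b)` (bsdN v4u/v5u of record: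
`residue:X11b,X7`, lane tail T-KOLY, other open cells `(719, X7)`); ALSO the unit's GEN 10 beyond-window DATA record in
`X11b/BeyondWindowRecords37.lean` (Skinner 2016 Thm. A ∘ Stein–Wuthrich 2013 `p`-adic road, binders as displayed there) — this row is a SECOND
road). `D = -2519` (2519 = 11·229): **`m = [E(K):ℤy_K] = 16`, `5 ∤ m`** (`ρ = 64.00…`; `L'(E,1) = 8.04436544…`, `L(E^D,1) = 0.00616080…`,
`ĥ(x) = 30.85500944…`) — engine 1 (j259809) = engine 2 (j260666; EQUAL, dev. ≤ 8.2·10⁻¹³, checks true); twist `E^D` (j260667):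
`#tors·∏c·#Ш_an = 2·64·1`, prime to `5` — BSD-consistent. Witnesses mod `5` `(ℓ,#Ẽ(𝔽_ℓ))` = `(23,18)` (`a = 6`, `a² − 4ℓ ≡ 4` square), `(19,12)`
(`a = 8`, `a² − 4ℓ ≡ 3` non-square), `(67,72)` (`u ≡ 3`).
[cite: McCallumLMS1991, §1 Theorem (Kolyvagin), p. 296] [cite: Serre1972, §2.8 Prop. 19] [cite: Cremona2006, Table 1 (label 303030bz1)] -/
theorem bsdp_k303030bz1_5 (hGZK : rank_eq_analyticRank_of_analyticRank_le_one) (W : WeierstrassCurve ℚ)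
    (hW : W = ⟨1, -1, 0, -3724542549, 87490703910645⟩) {N : ℕ} [NeZero N] {K : Type} [Field K] [NumberField K]
    (hKo : kolyvagin N W K) (hB : Kolyvagin1990_padicValNat_card_sha_le N W K) (hK : IsImaginaryQuadratic K)
    (hH : SatisfiesHeegnerHypothesis N K) {P : (W.baseChange K).toAffine.Point} (hP : IsHeegnerPoint N W K P)
    (hnt : ¬ IsOfFinAddOrder P) (hI : ¬ 5 ∣ (AddSubgroup.zmultiples P).index) (hr : W.analyticRank ≤ 1)
    {q : ℚ} (hq : shaAn W = (q : ℂ)) (hv : padicValRat 5 q = 0) : BSDp W 5 :=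
  bsdp_prime_of_kolyvaginIndex_of_serreCounts 5 (by norm_num) (by norm_num) 1 (-1) 0 (-3724542549) 87490703910645 (by decide +kernel)
    (by decide +kernel) (by decide +kernel) 23 19 67 (by norm_num) (by norm_num) (by norm_num) (by norm_num)
    (by norm_num) (by norm_num) (by norm_num) (by norm_num) (by norm_num) (by decide +kernel) (by decide +kernel)
    (by decide +kernel) (n₁ := 18) (n₂ := 12) (n₃ := 72) (hc₁ := by decide +kernel) (hc₂ := by decide +kernel)
    (hc₃ := by decide +kernel) (by decide +kernel) (by decide +kernel) (by decide +kernel) hGZK W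
    (by rw [hW]; norm_num) hKo hB hK hH hP hnt hI hr hq hv

/-- **`BSD(E,5)` for `303240a1`** (`N = 303240 = 2³·3·5·7·19²`; NON-SPLIT MULTIPLICATIVE at `5` (Kodaira `I1`, `c_5 = 1`, additive at `2`, `19`);
`#tors = 1`, `∏c = 4`, `r_an = 1`, `#Ш_an = 1`, generator `(0, 49)`; lane residue cell `(5, X11b)` (bsdN v4u/v5u of record: `residue:X11b`, lane
tail T-KOLY); ALSO the unit's GEN 10 beyond-window DATA record in `X11b/BeyondWindowRecords37.lean` (Skinner 2016 Thm. A ∘ Stein–Wuthrich 2013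
`p`-adic road, binders as displayed there) — this row is a SECOND road). `D = -1511` (1511 prime): **`m = [E(K):ℤy_K] = 48`, `5 ∤ m`**
(`ρ = 575.99…`; `L'(E,1) = 3.89832775…`, `L(E^D,1) = 4.42046777…`, `ĥ(x) = 0.74102593…`) — engine 1 (j259809) = engine 2 (j260666; EQUAL, dev. ≤
9.3·10⁻¹⁴, checks true); twist `E^D` (j260667): `#tors·∏c·#Ш_an = 1·8·36`, prime to `5` — BSD-consistent. Witnesses mod `5` `(ℓ,#Ẽ(𝔽_ℓ))` =
`(17,11)` (`a = 7`, `a² − 4ℓ ≡ 1` square), `(11,18)` (`a = -6`, `a² − 4ℓ ≡ 2` non-square), `(13,12)` (`u ≡ 3`).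
[cite: McCallumLMS1991, §1 Theorem (Kolyvagin), p. 296] [cite: Serre1972, §2.8 Prop. 19] [cite: Cremona2006, Table 1 (label 303240a1)] -/
theorem bsdp_k303240a1_5 (hGZK : rank_eq_analyticRank_of_analyticRank_le_one) (W : WeierstrassCurve ℚ)
    (hW : W = ⟨0, -1, 0, -196, 2401⟩) {N : ℕ} [NeZero N] {K : Type} [Field K] [NumberField K]
    (hKo : kolyvagin N W K) (hB : Kolyvagin1990_padicValNat_card_sha_le N W K) (hK : IsImaginaryQuadratic K)
    (hH : SatisfiesHeegnerHypothesis N K) {P : (W.baseChange K).toAffine.Point} (hP : IsHeegnerPoint N W K P)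
    (hnt : ¬ IsOfFinAddOrder P) (hI : ¬ 5 ∣ (AddSubgroup.zmultiples P).index) (hr : W.analyticRank ≤ 1)
    {q : ℚ} (hq : shaAn W = (q : ℂ)) (hv : padicValRat 5 q = 0) : BSDp W 5 :=
  bsdp_prime_of_kolyvaginIndex_of_serreCounts 5 (by norm_num) (by norm_num) 0 (-1) 0 (-196) 2401 (by decide +kernel)
    (by decide +kernel) (by decide +kernel) 17 11 13 (by norm_num) (by norm_num) (by norm_num) (by norm_num)
    (by norm_num) (by norm_num) (by norm_num) (by norm_num) (by norm_num) (by decide +kernel) (by decide +kernel)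
    (by decide +kernel) (n₁ := 11) (n₂ := 18) (n₃ := 12) (hc₁ := by decide +kernel) (hc₂ := by decide +kernel)
    (hc₃ := by decide +kernel) (by decide +kernel) (by decide +kernel) (by decide +kernel) hGZK W
    (by rw [hW]; norm_num) hKo hB hK hH hP hnt hI hr hq hv

/-- **`BSD(E,5)` for `305760b1`** (`N = 305760 = 2⁵·3·5·7²·13`; NON-SPLIT MULTIPLICATIVE at `5` (Kodaira `I1`, `c_5 = 1`, additive at `2`, `7`);
`#tors = 1`, `∏c = 1`, `r_an = 1`, `#Ш_an = 1`, generator Cremona's (17-digit numerator); lane residue cell `(5, X11b)` (bsdN v4u/v5u of record: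
`residue:X11b`, lane tail T-KOLY); ALSO the unit's GEN 10 beyond-window DATA record in `X11b/BeyondWindowRecords37.lean` (Skinner 2016 Thm. A ∘
Stein–Wuthrich 2013 `p`-adic road, binders as displayed there) — this row is a SECOND road). `D = -1511` (1511 prime): **`m = [E(K):ℤy_K] = 24`,
`5 ∤ m`** (`ρ = 143.99…`; `L'(E,1) = 5.61439301…`, `L(E^D,1) = 1.29647552…`, `ĥ(x) = 38.70408441…`) — engine 1 (j259809) = engine 2 (j260666; EQUAL,
dev. ≤ 3.2·10⁻¹⁴, checks true); twist `E^D` (j260667): `#tors·∏c·#Ш_an = 1·2·144`, prime to `5` — BSD-consistent. Witnesses mod `5` `(ℓ,#Ẽ(𝔽_ℓ))` =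
`(17,15)` (`a = 3`, `a² − 4ℓ ≡ 1` square), `(11,18)` (`a = -6`, `a² − 4ℓ ≡ 2` non-square), `(37,42)` (`u ≡ 3`).
[cite: McCallumLMS1991, §1 Theorem (Kolyvagin), p. 296] [cite: Serre1972, §2.8 Prop. 19] [cite: Cremona2006, Table 1 (label 305760b1)] -/
theorem bsdp_k305760b1_5 (hGZK : rank_eq_analyticRank_of_analyticRank_le_one) (W : WeierstrassCurve ℚ)
    (hW : W = ⟨0, -1, 0, 248904, -39711384⟩) {N : ℕ} [NeZero N] {K : Type} [Field K] [NumberField K]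
    (hKo : kolyvagin N W K) (hB : Kolyvagin1990_padicValNat_card_sha_le N W K) (hK : IsImaginaryQuadratic K)
    (hH : SatisfiesHeegnerHypothesis N K) {P : (W.baseChange K).toAffine.Point} (hP : IsHeegnerPoint N W K P)
    (hnt : ¬ IsOfFinAddOrder P) (hI : ¬ 5 ∣ (AddSubgroup.zmultiples P).index) (hr : W.analyticRank ≤ 1)
    {q : ℚ} (hq : shaAn W = (q : ℂ)) (hv : padicValRat 5 q = 0) : BSDp W 5 :=
  bsdp_prime_of_kolyvaginIndex_of_serreCounts 5 (by norm_num) (by norm_num) 0 (-1) 0 248904 (-39711384) (by decide +kernel)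
    (by decide +kernel) (by decide +kernel) 17 11 37 (by norm_num) (by norm_num) (by norm_num) (by norm_num)
    (by norm_num) (by norm_num) (by norm_num) (by norm_num) (by norm_num) (by decide +kernel) (by decide +kernel)
    (by decide +kernel) (n₁ := 15) (n₂ := 18) (n₃ := 42) (hc₁ := by decide +kernel) (hc₂ := by decide +kernel)
    (hc₃ := by decide +kernel) (by decide +kernel) (by decide +kernel) (by decide +kernel) hGZK W
    (by rw [hW]; norm_num) hKo hB hK hH hP hnt hI hr hq hv

end Summit.BirchSwinnertonDyer.Rank1Residual.X11b

end
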